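import Literature.NumberTheory.EllipticCurves.IwasawaAlgebraSpecializationTorsionBoundProofs
import Literature.NumberTheory.EllipticCurves.IwasawaAlgebraInvolution
import HarnessLib

/-!
# Uniform torsion bounds along ANY family of pairwise non-associated primes of `Λ`, and along the
# `ι`-conjugate Eisenstein family `ι(q_m) = ι(T^m + p)` (module theory over `Λ = ℤ_p⟦T⟧`; proofs file)

Topic `NumberTheory/EllipticCurves`. THEOREMS ONLY (no definition, no named fact, no instance, no
`sorry`). Sequel to `IwasawaAlgebraSpecializationTorsionBoundProofs` (Howard's family `q_m = T^m + p`).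

WHAT.
* §7 (general families). Let `θ : ι → Λ` be a family of PRIME elements of `Λ = ℤ_p⟦T⟧`, pairwise
  non-associated (`Associated (θ i) (θ j) → i = j`). For a finitely generated `Λ`-module `M`:
  `M[θ i]` is finite for all but finitely many `i` (`finite_setOf_not_finite_torsionBy_of_prime_family`);
  `M[θ i] ⊆ M_fin` (the largest finite submodule) for all but finitely many `i`
  (`finite_setOf_not_torsionBy_le_of_prime_family`, `exists_finite_setOf_not_torsionBy_le_of_prime_family`);
  and in a module without non-zero finite submodules `M[θ i] = 0` for all but finitely many `i`
  (`finite_setOf_torsionBy_ne_bot_of_prime_family`). This subsumes Greenberg's linear family `T − c`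
  (`IwasawaAlgebraGenericTwistFiniteProofs` §4/§8) and Howard's `q_m`
  (`IwasawaAlgebraSpecializationTorsionBoundProofs` §4/§6).
* §8 (the `ι`-conjugate Eisenstein family). With `ι : Λ ≃ Λ`, `T ↦ (1+T)⁻¹ − 1` the Iwasawa involution
  (`IwasawaAlgebra.invol`, `involEquiv`): `ι(q_m)` is prime and non-unit for `m ≥ 1`, and `ι(q_m)`,
  `ι(q_{m'})` are non-associated for `m ≠ m'` (`prime_invol_X_pow_add_C`,
  `eq_of_associated_invol_X_pow_add_C`); hence (`exists_forall_torsionBy_invol_X_pow_add_C_le`,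
  `exists_forall_nat_card_torsionBy_invol_X_pow_add_C_le`, `exists_forall_torsionBy_invol_X_pow_add_C_eq_bot`)
  **`M[ι(q_m)] ⊆ M_fin` and `#M[ι(q_m)] ≤ B` for all `m ≥ m₀`**, and `M[ι(q_m)] = 0` for `m ≥ m₀` when `M`
  has no non-zero finite submodule.

WHY (use). In the control theorem at Howard's Eisenstein primes `𝔮 = q_m` the DISCRETE side is run
through local and global duality, which pairs `𝔮` with its conjugate `𝔮^ι` under the involution of `Λ`
[Howard 2004, §2.2 (the modules `T_𝔮`, `A_{𝔮^ι}` and the pairing of Lemma 2.1.1 / (2.2)); Greenberg,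
LNM 1716, §1 p. 60 (the two `Λ`-structures on a Pontryagin dual differ by `ι`)]; `q_m = T^m + p` is not
`ι`-stable, so the `𝔮^ι`-torsion error terms (`H²(K_Σ/K, 𝐓)[𝔮^ι]`, `H⁰`-terms of duals) need the same
`m`-uniform cardinality bound as the `𝔮`-torsion ones — §8 — for the `m → ∞` limit reading off
`μ`-invariants (cell `pub/bsd-print-x9`, crux idea `specialise-first-mu-x10b`, S1 ledger; the tree's
`IwasawaAlgebra.lengthAt_le_two_mul_of_card_quotSMulTop_qm_le`). Pure commutative algebra; nothing about
Galois cohomology is asserted here.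

References: [Howard2004HeegnerKolyvagin] B. Howard, Compositio Math. 140 (2004), §2.1–2.2 and proof of
Thm. 2.2.10; [GreenbergLNM1716] R. Greenberg, LNM 1716 (1999), §1 p. 60, §4 p. 117; [Washington1997]
§7.1, §13.2; [MazurTateTeitelbaum1986Invent] Ch. I §17 (the involution); [NeukirchSchmidtWingberg2008]
Ch. V §1 (5.1.4) Remark 4, (5.3.1).
-/

noncomputable section

open scoped Classical

universe u

namespace Literature.NumberTheory.EllipticCurves.IwasawaAlgebra

variable (p : ℕ) [hp : Fact p.Prime]

/-! ## §7 Families of pairwise non-associated primes of `Λ` -/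

section Family

variable {ι : Type*} {θ : ι → IwasawaAlgebra p}

/-- **Finitely many members of a prime family divide a given `f ≠ 0`**: each `θ i ∣ f` is associated to a
member of the finite multiset of prime factors of `f` in the factorial ring `Λ`, and distinct indices give
non-associated primes. [cite: Washington1997, §13.2 (`Λ` is a UFD)] [cite: GreenbergLNM1716, §4 p. 117] -/
theorem finite_setOf_dvd_of_prime_family (hθ : ∀ i, Prime (θ i))
    (hinj : ∀ i j, Associated (θ i) (θ j) → i = j) {f : IwasawaAlgebra p} (hf : f ≠ 0) :
    {i : ι | θ i ∣ f}.Finite := by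
  set S : Set ι := {i : ι | θ i ∣ f} with hS
  have key : ∀ i ∈ S, ∃ q ∈ UniqueFactorizationMonoid.factors f, Associated (θ i) q :=
    fun i hi => UniqueFactorizationMonoid.exists_mem_factors_of_dvd hf (hθ i).irreducible hi
  choose q hqmem hq using key
  let F : Finset (IwasawaAlgebra p) := (UniqueFactorizationMonoid.factors f).toFinset
  let φ : S → F := fun i => ⟨q i.1 i.2, Multiset.mem_toFinset.mpr (hqmem i.1 i.2)⟩
  have hφ : Function.Injective φ := by
    rintro ⟨i, hi⟩ ⟨j, hj⟩ h
    have hqq : q i hi = q j hj := congrArg Subtype.val h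
    have h' : Associated (θ j) (q i hi) := by rw [hqq]; exact hq j hj
    exact Subtype.ext (hinj i j ((hq i hi).trans h'.symm))
  haveI : Finite S := Finite.of_injective φ hφ
  exact Set.toFinite S

/-- **`Λ/(f, θ)` is finite for a prime `θ ∤ f`**: the ideal `(f, θ)` is non-zero and lies in no proper
principal ideal, so the quotient is pseudo-null, i.e. finite (`finite_quotient_of_forall_not_le_span`).
[cite: NeukirchSchmidtWingberg2008, Ch. V §1 (5.1.4) Remark 4] [cite: Washington1997, §13.2] -/
theorem finite_quotient_span_pair_of_prime {f θ : IwasawaAlgebra p} (hθ : Prime θ) (h : ¬ θ ∣ f) :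
    Finite (IwasawaAlgebra p ⧸ Ideal.span ({f, θ} : Set (IwasawaAlgebra p))) := by
  refine finite_quotient_of_forall_not_le_span _ ?_ ?_
  · intro hbot
    have hmem : θ ∈ Ideal.span ({f, θ} : Set (IwasawaAlgebra p)) := Ideal.subset_span (by simp)
    rw [hbot, Ideal.mem_bot] at hmem
    exact hθ.ne_zero hmem
  · intro π hπ hle
    have h1 : θ ∈ Ideal.span {π} := hle (Ideal.subset_span (by simp))
    have hfπ : f ∈ Ideal.span {π} := hle (Ideal.subset_span (by simp))
    rw [Ideal.mem_span_singleton] at h1 hfπ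
    obtain ⟨u, hu⟩ := h1
    rcases hθ.irreducible.isUnit_or_isUnit hu with hπu | huu
    · exact hπ hπu
    · apply h
      obtain ⟨v, rfl⟩ := huu
      have hπeq : π = θ * (↑v⁻¹ : IwasawaAlgebra p) := by rw [hu, mul_assoc, Units.mul_inv, mul_one]
      rw [hπeq] at hfπ
      exact (dvd_mul_right _ _).trans hfπ

variable {M : Type u} [AddCommGroup M] [Module (IwasawaAlgebra p) M]

/-- A finitely generated `Λ`-module killed by `f` and by a prime `θ ∤ f` is finite (a module over the
finite ring `Λ/(f, θ)`). [cite: NeukirchSchmidtWingberg2008, Ch. V §1 (5.1.4) Remark 4] -/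
theorem finite_of_smul_eq_zero_of_prime_not_dvd [Module.Finite (IwasawaAlgebra p) M]
    {f θ : IwasawaAlgebra p} (hθ : Prime θ) (h : ¬ θ ∣ f)
    (hf : ∀ x : M, f • x = 0) (hθx : ∀ x : M, θ • x = 0) : Finite M := by
  haveI := finite_quotient_span_pair_of_prime p hθ h
  refine finite_of_finite_quotient_of_le_annihilator p (Ideal.span ({f, θ} : Set (IwasawaAlgebra p))) ?_
  rw [Ideal.span_le]
  intro a ha
  simp only [Set.mem_insert_iff, Set.mem_singleton_iff] at ha
  rcases ha with rfl | rfl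
  · exact Module.mem_annihilator.mpr hf
  · exact Module.mem_annihilator.mpr hθx

/-- **Generic finiteness along a prime family.** For `M` finitely generated and `θ` a family of pairwise
non-associated primes, `M[θ i]` is finite for all but finitely many `i` (the exceptional `i` divide a fixed
non-zero annihilator of `M_{Λ-tors} ⊇ M[θ i]`). [cite: GreenbergLNM1716, §4 p. 117 (proof of Prop. 4.9)] -/
theorem finite_setOf_not_finite_torsionBy_of_prime_family [Module.Finite (IwasawaAlgebra p) M]
    (hθ : ∀ i, Prime (θ i)) (hinj : ∀ i j, Associated (θ i) (θ j) → i = j) :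
    {i : ι | ¬ Finite (Submodule.torsionBy (IwasawaAlgebra p) M (θ i))}.Finite := by
  haveI : IsNoetherian (IwasawaAlgebra p) M := inferInstance
  obtain ⟨f, hfann, hf0⟩ := Submodule.annihilator_top_inter_nonZeroDivisors
    (R := IwasawaAlgebra p) (M := Submodule.torsion (IwasawaAlgebra p) M)
    (Submodule.torsion_isTorsion)
  have hf0' : f ≠ 0 := nonZeroDivisors.ne_zero hf0
  refine (finite_setOf_dvd_of_prime_family p hθ hinj hf0').subset ?_
  intro i hnot
  change ¬ Finite _ at hnot
  change θ i ∣ f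
  by_contra hndvd
  apply hnot
  refine finite_of_smul_eq_zero_of_prime_not_dvd p (hθ i) hndvd ?_ ?_
  · rintro ⟨x, hx⟩
    have hxt : x ∈ Submodule.torsion (IwasawaAlgebra p) M :=
      ⟨⟨θ i, mem_nonZeroDivisors_of_ne_zero (hθ i).ne_zero⟩, (Submodule.mem_torsionBy_iff _ _).mp hx⟩
    have h1 := (Submodule.mem_annihilator.mp hfann) ⟨x, hxt⟩ Submodule.mem_top
    apply Subtype.ext
    have h2 := congrArg Subtype.val h1
    simpa using h2
  · rintro ⟨x, hx⟩
    exact Subtype.ext ((Submodule.mem_torsionBy_iff _ _).mp hx)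

/-- **Along a prime family the torsion lies in the largest finite submodule, with finitely many
exceptions**: if `F` is a finite submodule containing every finite submodule of the finitely generated
module `M`, then `M[θ i] ≤ F` for all but finitely many `i` (on `M/F`, which has no non-zero finite
submodule, a finite `(M/F)[θ i]` vanishes). [cite: GreenbergLNM1716, §4 p. 117 and p. 124] -/
theorem finite_setOf_not_torsionBy_le_of_prime_family [Module.Finite (IwasawaAlgebra p) M]
    (F : Submodule (IwasawaAlgebra p) M) [Finite F]
    (hF : ∀ G : Submodule (IwasawaAlgebra p) M, Finite G → G ≤ F)
    (hθ : ∀ i, Prime (θ i)) (hinj : ∀ i j, Associated (θ i) (θ j) → i = j) :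
    {i : ι | ¬ Submodule.torsionBy (IwasawaAlgebra p) M (θ i) ≤ F}.Finite := by
  have hquot := forall_finite_eq_bot_quotient_of_forall_finite_le F hF
  refine (finite_setOf_not_finite_torsionBy_of_prime_family p (M := M ⧸ F) hθ hinj).subset ?_
  intro i hi
  change ¬ _ ≤ F at hi
  change ¬ Finite _
  intro hfin
  apply hi
  have hbot := torsionBy_eq_bot_of_forall_finite_eq_bot p hquot (θ i)
  intro x hx
  have hx' : F.mkQ x ∈ Submodule.torsionBy (IwasawaAlgebra p) (M ⧸ F) (θ i) := by
    rw [Submodule.mem_torsionBy_iff] at hx ⊢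
    rw [← map_smul, hx, map_zero]
  rw [hbot, Submodule.mem_bot, Submodule.mkQ_apply, Submodule.Quotient.mk_eq_zero] at hx'
  exact hx'

/-- **Submodule form**: a finitely generated `Λ`-module has a finite submodule `F` with `M[θ i] ≤ F` for
all but finitely many members of any family of pairwise non-associated primes.
[cite: GreenbergLNM1716, §4 p. 117] -/
theorem exists_finite_setOf_not_torsionBy_le_of_prime_family [Module.Finite (IwasawaAlgebra p) M]
    (hθ : ∀ i, Prime (θ i)) (hinj : ∀ i j, Associated (θ i) (θ j) → i = j) :
    ∃ F : Submodule (IwasawaAlgebra p) M, Finite F ∧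
      {i : ι | ¬ Submodule.torsionBy (IwasawaAlgebra p) M (θ i) ≤ F}.Finite := by
  haveI : IsNoetherian (IwasawaAlgebra p) M := inferInstance
  obtain ⟨F, hF, hmax⟩ := exists_finite_submodule_forall_finite_le (R := IwasawaAlgebra p) (M := M)
  haveI : Finite F := hF
  exact ⟨F, hF, finite_setOf_not_torsionBy_le_of_prime_family p F hmax hθ hinj⟩

/-- **No finite submodule ⟹ `M[θ i] = 0` with finitely many exceptions** along any family of pairwise
non-associated primes. [cite: GreenbergLNM1716, §4 p. 117 and p. 124] -/
theorem finite_setOf_torsionBy_ne_bot_of_prime_family [Module.Finite (IwasawaAlgebra p) M]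
    (h : ∀ N : Submodule (IwasawaAlgebra p) M, Finite N → N = ⊥)
    (hθ : ∀ i, Prime (θ i)) (hinj : ∀ i j, Associated (θ i) (θ j) → i = j) :
    {i : ι | Submodule.torsionBy (IwasawaAlgebra p) M (θ i) ≠ ⊥}.Finite := by
  refine (finite_setOf_not_finite_torsionBy_of_prime_family p (M := M) hθ hinj).subset ?_
  intro i hi
  change _ ≠ ⊥ at hi
  change ¬ Finite _
  intro hfin
  exact hi (torsionBy_eq_bot_of_forall_finite_eq_bot p h _)

end Family

/-! ## §8 The `ι`-conjugate Eisenstein family `ι(q_m)`, `q_m = T^m + p` -/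

/-- `ι(q_m)` is a prime element of `Λ` for `m ≥ 1` (image of the prime `q_m` under the ring automorphism
`ι`). [cite: MazurTateTeitelbaum1986Invent, Ch. I §17] [cite: Washington1997, §7.1 and §13.2] -/
theorem prime_invol_X_pow_add_C {m : ℕ} (hm : 1 ≤ m) :
    Prime (invol p (PowerSeries.X ^ m + PowerSeries.C (p : ℤ_[p]) : IwasawaAlgebra p)) := by
  rw [← involEquiv_apply]
  exact (MulEquiv.prime_iff (involEquiv p)).mpr (prime_X_pow_add_C p hm)

/-- `ι(q_m)` is not a unit of `Λ` for `m ≥ 1` (`ι` preserves units and `ι ∘ ι = id`).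
[cite: MazurTateTeitelbaum1986Invent, Ch. I §17] -/
theorem not_isUnit_invol_X_pow_add_C {m : ℕ} (hm : 1 ≤ m) :
    ¬ IsUnit (invol p (PowerSeries.X ^ m + PowerSeries.C (p : ℤ_[p]) : IwasawaAlgebra p)) :=
  (prime_invol_X_pow_add_C p hm).not_unit

/-- Distinct `m, m' ≥ 1` give non-associated `ι(q_m)`, `ι(q_{m'})` (apply `ι` and use
`eq_of_associated_X_pow_add_C`). [cite: MazurTateTeitelbaum1986Invent, Ch. I §17] [cite: Washington1997, Prop. 13.8] -/
theorem eq_of_associated_invol_X_pow_add_C {m m' : ℕ} (hm : 1 ≤ m) (hm' : 1 ≤ m')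
    (h : Associated (invol p (PowerSeries.X ^ m + PowerSeries.C (p : ℤ_[p]) : IwasawaAlgebra p))
      (invol p (PowerSeries.X ^ m' + PowerSeries.C (p : ℤ_[p])))) : m = m' := by
  have h' := h.map (invol p)
  rw [invol_invol, invol_invol] at h'
  exact eq_of_associated_X_pow_add_C p hm hm' h'

section InvolModule

variable {M : Type u} [AddCommGroup M] [Module (IwasawaAlgebra p) M]

/-- `M[ι(q_m)]` is finite for all but finitely many `m` (`M` finitely generated; for `m = 0`,
`ι(q_0) = 1 + p` is a unit and the torsion vanishes). [cite: GreenbergLNM1716, §4 p. 117]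
[cite: Howard2004HeegnerKolyvagin, §2.2 and proof of Thm. 2.2.10] -/
theorem finite_setOf_not_finite_torsionBy_invol_X_pow_add_C [Module.Finite (IwasawaAlgebra p) M] :
    {m : ℕ | ¬ Finite (Submodule.torsionBy (IwasawaAlgebra p) M
        (invol p (PowerSeries.X ^ m + PowerSeries.C (p : ℤ_[p]) : IwasawaAlgebra p)))}.Finite := by
  -- the shifted family `m ↦ ι(q_{m+1})` consists of pairwise non-associated primes
  have hθ : ∀ i : ℕ, Prime (invol p (PowerSeries.X ^ (i + 1) + PowerSeries.C (p : ℤ_[p]) : IwasawaAlgebra p)) :=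
    fun i => prime_invol_X_pow_add_C p (by omega)
  have hinj : ∀ i j : ℕ, Associated (invol p (PowerSeries.X ^ (i + 1) + PowerSeries.C (p : ℤ_[p]) : IwasawaAlgebra p))
      (invol p (PowerSeries.X ^ (j + 1) + PowerSeries.C (p : ℤ_[p]))) → i = j :=
    fun i j h => by have := eq_of_associated_invol_X_pow_add_C p (by omega) (by omega) h; omega
  have hfin := finite_setOf_not_finite_torsionBy_of_prime_family p (M := M) hθ hinj
  -- `m = 0`: unit, torsion `= ⊥`
  have h0 : Finite (Submodule.torsionBy (IwasawaAlgebra p) M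
      (invol p (PowerSeries.X ^ 0 + PowerSeries.C (p : ℤ_[p]) : IwasawaAlgebra p))) := by
    have hu : IsUnit (invol p (PowerSeries.X ^ 0 + PowerSeries.C (p : ℤ_[p]) : IwasawaAlgebra p)) := by
      refine IsUnit.map (invol p) ?_
      rw [PowerSeries.isUnit_iff_constantCoeff, map_add, pow_zero, map_one, PowerSeries.constantCoeff_C]
      have : (1 : ℤ_[p]) + p ∉ IsLocalRing.maximalIdeal ℤ_[p] := by
        intro hmem
        have hpmem : (p : ℤ_[p]) ∈ IsLocalRing.maximalIdeal ℤ_[p] := by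
          rw [PadicInt.maximalIdeal_eq_span_p]; exact Ideal.mem_span_singleton_self _
        have h1 : (1 : ℤ_[p]) ∈ IsLocalRing.maximalIdeal ℤ_[p] := by
          simpa using Submodule.sub_mem _ hmem hpmem
        exact (IsLocalRing.maximalIdeal.isMaximal ℤ_[p]).ne_top ((Ideal.eq_top_iff_one _).mpr h1)
      exact (IsLocalRing.notMem_maximalIdeal).mp this
    rw [(isSMulRegular_iff_torsionBy_eq_bot M _).mp (hu.isSMulRegular M)]
    infer_instance
  refine ((hfin.image Nat.succ).union (Set.finite_singleton 0)).subset ?_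
  intro m hm
  change ¬ Finite _ at hm
  rcases Nat.eq_zero_or_pos m with rfl | hpos
  · exact absurd h0 hm
  · left
    refine ⟨m - 1, ?_, by change m - 1 + 1 = m; omega⟩
    change ¬ Finite _
    have : m - 1 + 1 = m := by omega
    rw [this]
    exact hm

/-- **`M[ι(q_m)] ⊆ M_fin` for `m ≥ m₀`**: a finitely generated `Λ`-module has a finite submodule `F`
and an `m₀` with `M[ι(q_m)] ≤ F` for all `m ≥ m₀`. [cite: GreenbergLNM1716, §4 p. 117]
[cite: Howard2004HeegnerKolyvagin, §2.2 and proof of Thm. 2.2.10] -/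
theorem exists_forall_torsionBy_invol_X_pow_add_C_le [Module.Finite (IwasawaAlgebra p) M] :
    ∃ (F : Submodule (IwasawaAlgebra p) M) (m₀ : ℕ), Finite F ∧ ∀ m, m₀ ≤ m →
      Submodule.torsionBy (IwasawaAlgebra p) M
        (invol p (PowerSeries.X ^ m + PowerSeries.C (p : ℤ_[p]) : IwasawaAlgebra p)) ≤ F := by
  have hθ : ∀ i : ℕ, Prime (invol p (PowerSeries.X ^ (i + 1) + PowerSeries.C (p : ℤ_[p]) : IwasawaAlgebra p)) :=
    fun i => prime_invol_X_pow_add_C p (by omega)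
  have hinj : ∀ i j : ℕ, Associated (invol p (PowerSeries.X ^ (i + 1) + PowerSeries.C (p : ℤ_[p]) : IwasawaAlgebra p))
      (invol p (PowerSeries.X ^ (j + 1) + PowerSeries.C (p : ℤ_[p]))) → i = j :=
    fun i j h => by have := eq_of_associated_invol_X_pow_add_C p (by omega) (by omega) h; omega
  obtain ⟨F, hF, hfin⟩ := exists_finite_setOf_not_torsionBy_le_of_prime_family p (M := M) hθ hinj
  obtain ⟨i₀, hi₀⟩ := hfin.bddAbove
  refine ⟨F, i₀ + 2, hF, fun m hm => ?_⟩
  have hm' : m - 1 + 1 = m := by omega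
  by_contra hnot
  have hmem : m - 1 ∈ {i : ℕ | ¬ Submodule.torsionBy (IwasawaAlgebra p) M
      (invol p (PowerSeries.X ^ (i + 1) + PowerSeries.C (p : ℤ_[p]) : IwasawaAlgebra p)) ≤ F} := by
    change ¬ _ ≤ F
    rw [hm']
    exact hnot
  have := hi₀ hmem
  omega

/-- **Cardinality form (the `m`-uniform bound for the `ι`-conjugate family)**: there are `B ≥ 1` and `m₀`
with `M[ι(q_m)]` finite and `#M[ι(q_m)] ≤ B` for all `m ≥ m₀`.
[cite: Howard2004HeegnerKolyvagin, §2.2 and proof of Thm. 2.2.10] [cite: GreenbergLNM1716, §4 p. 117] -/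
theorem exists_forall_nat_card_torsionBy_invol_X_pow_add_C_le [Module.Finite (IwasawaAlgebra p) M] :
    ∃ B m₀ : ℕ, 1 ≤ B ∧ ∀ m, m₀ ≤ m →
      Finite (Submodule.torsionBy (IwasawaAlgebra p) M
        (invol p (PowerSeries.X ^ m + PowerSeries.C (p : ℤ_[p]) : IwasawaAlgebra p))) ∧
      Nat.card (Submodule.torsionBy (IwasawaAlgebra p) M
        (invol p (PowerSeries.X ^ m + PowerSeries.C (p : ℤ_[p]) : IwasawaAlgebra p))) ≤ B := by
  obtain ⟨F, m₀, hF, hle⟩ := exists_forall_torsionBy_invol_X_pow_add_C_le p (M := M)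
  haveI : Finite F := hF
  refine ⟨Nat.card F, m₀, ?_, fun m hm => ?_⟩
  · haveI : Nonempty F := ⟨0⟩
    exact Nat.one_le_iff_ne_zero.mpr Nat.card_pos.ne'
  · have hinj : Function.Injective (Submodule.inclusion (hle m hm)) := Submodule.inclusion_injective _
    haveI : Finite (Submodule.torsionBy (IwasawaAlgebra p) M
        (invol p (PowerSeries.X ^ m + PowerSeries.C (p : ℤ_[p]) : IwasawaAlgebra p))) :=
      Finite.of_injective _ hinj
    exact ⟨inferInstance, Nat.card_le_card_of_injective _ hinj⟩

/-- **No finite submodule ⟹ `M[ι(q_m)] = 0` for `m ≥ m₀`** (`M` finitely generated).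
[cite: GreenbergLNM1716, §4 p. 117 and p. 124] [cite: Howard2004HeegnerKolyvagin, §2.2] -/
theorem exists_forall_torsionBy_invol_X_pow_add_C_eq_bot [Module.Finite (IwasawaAlgebra p) M]
    (h : ∀ N : Submodule (IwasawaAlgebra p) M, Finite N → N = ⊥) :
    ∃ m₀ : ℕ, ∀ m, m₀ ≤ m → Submodule.torsionBy (IwasawaAlgebra p) M
        (invol p (PowerSeries.X ^ m + PowerSeries.C (p : ℤ_[p]) : IwasawaAlgebra p)) = ⊥ := by
  obtain ⟨m₀, hm₀⟩ := (finite_setOf_not_finite_torsionBy_invol_X_pow_add_C p (M := M)).bddAbove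
  refine ⟨m₀ + 1, fun m hm => ?_⟩
  have hfin : Finite (Submodule.torsionBy (IwasawaAlgebra p) M
      (invol p (PowerSeries.X ^ m + PowerSeries.C (p : ℤ_[p]) : IwasawaAlgebra p))) := by
    by_contra hnot
    have := hm₀ hnot
    omega
  exact torsionBy_eq_bot_of_forall_finite_eq_bot p h _

end InvolModule

end Literature.NumberTheory.EllipticCurves.IwasawaAlgebra

end
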